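import Summits.BirchSwinnertonDyer.BirchSwinnertonDyer.Theorems.PrintCf2RubinValueTwoCMDivisionTowerFrameSigns
import Summits.BirchSwinnertonDyer.BirchSwinnertonDyer.Theorems.PrintCf2RubinValueTwoCMDivisionTowerAvatarLink
import Literature.NumberTheory.EllipticCurves.HeckeGrossencharakterFunctionalEquation
import HarnessLib

/-!
# Division-tower alignment, file 5: DEEP LAYERS AND THE SIGN-FLIP — the core's (H5)–(H6) on the DA7 frame: the bridge (L′) in
# «raw Frobenius-link» form (serving BOTH infinity types of the dictionary's `ψ′ ∈ {ψ_E, ψ_E ∘ c}`), the junction `χ|_Υ = θ|_Υ`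
# read in `ℤ₂ˣ`, «deep layers act by signs, the `M_A`-sign being `θ`», and the sign-flip `τ₀ ∈ I_B ∩ Υ ∩ ker θ`

Cell `bsd-print-cf2`, width seat `bsd-line-cf2-p1-w8` g7; `--supports` stmt-BirchSwinnertonDyer-23300 (helper).  Fifth file of the
DIVISION-TOWER ALIGNMENT residual (T-a)–(T-d) of LEAD's v2.6 `stub_towerDescentT1` (hypotheses of -w7 g9's p736536).

* §1 `(L′)`: file 2's bridge with the Deuring component replaced by its two used clauses — stability and a raw Frobenius link
  `∃ a, φ₀ a = ι⁻¹(ψ(ϖ_𝔮)) ∧ Frob acts as a (mod 𝔭^k)` (private `intCast_eq_toZModPow_inv_of_frobLink`, density as in file 2, exported as the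
  sign criterion `smul_generator_eq_self_iff_and_eq_neg_iff_of_frobLink`); the link holds for
  `(ψ_E, v, E[v^∞], φ₀)` (`frobLink_of_isPrimaryComponent`) AND for `(ψ_E ∘ c, v̄, E[v̄^∞], φ₀ ∘ c⁻¹)` (`frobLink_galConj_of_isPrimaryComponent`:
  `(ψ_E∘c)(ϖ_𝔮) = \overline{ψ_E(ϖ_𝔮)}`, tree `IsHeckeConjEquivariant.valueAtUniformizer_galConj'`, and `σ_w ∘ c⁻¹ = σ̄_w`, file 4).
* §2 `units_eq_of_junction` (the class door's junction `θ(υ) = r′(υ)` in `ℂ₂` read in `ℤ₂ˣ`), ★ `exists_forall_deep_signs` — (H5): for `j ≥ 2`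
  some `Gal(K̄/K̃_N)` acts on `g_A^{(j)}` by the sign `θ` and on `g_B^{(j)}` by a sign (openness + JLK cofinality + Weil).
* §3 ★ `tau0_spec` — (H6): an element of `I_B ∩ Υ` moving `√−1` (-w8 g6 F2′) fixes `M_A`, has `θ = 1`, and negates every `g_B^{(j)}`.

THEOREMS ONLY (no `def`, no named fact, no `sorry`); Theses-free.  HONEST FRAMING: bookkeeping over tree theorems and files 1–4; closes nothing;
beyond-print theorem: no.  No summit statement is proved by this seat; BSD is not proved by any of this.

References: [Rubin1999] LNM 1716 §5 Thm. 5.15, Cor. 5.16; [SerreAbelianLadic1968] Ch. I §2.2–2.3, Ch. II §2.7; [SilvermanAEC2009] III.8.1;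
[Washington1997] §13.1; [Jia2026ActaArith] §1 (conj-equivariant characters).
-/

-- the summit namespace `Summit.BirchSwinnertonDyer.BirchSwinnertonDyer` repeats the problem name by design (D-0017)
set_option linter.dupNamespace false
set_option autoImplicit false

noncomputable section

open scoped Classical

open Field NumberField IsDedekindDomain WeierstrassCurve Literature.NumberTheory.EllipticCurves
  Literature.NumberTheory.EllipticCurves.DeuringGaloisAction Literature.NumberTheory.GaloisRepresentations
  Literature.NumberTheory.ComplexMultiplication.EllipticUnits
  Literature.NumberTheory.EllipticCurves.WeilPairingCyclicComponents
open Summit.BirchSwinnertonDyer.BirchSwinnertonDyer.Theorems.PrintCf2.AvatarRigidity (entry_eq_of_isPAdicAvatarOf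
  eventually_notMem_and_isUnramifiedAt)
open Summit.BirchSwinnertonDyer.BirchSwinnertonDyer.Theorems.PrintCf2.HPrime (cyclotomicCharacter_eq_one_or_eq_neg_one_of_mem_pairKer
  cyclotomicCharacter_eq_neg_one_iff_smul_sqrt_neg_one)

namespace Summit.BirchSwinnertonDyer.BirchSwinnertonDyer.Theorems.PrintCf2.CMDivisionTower

variable {K : Type} [Field K] [NumberField K]

/-! ## §1. `(L′)`: the bridge from a raw Frobenius link -/

section LinkRaw

variable (W : WeierstrassCurve K) {ψ : HeckeCharacter K} {𝔭 : HeightOneSpectrum (𝓞 K)} {M : AddSubgroup (geomPrimaryTorsion W 2)}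
  (hst : ∀ σ : absoluteGaloisGroup K, ∀ x ∈ M, σ • x ∈ M)
  (ι : PadicAlgCl 2 ≃+* ℂ) {r : FramedGaloisRep K (PadicAlgCl 2) 1} (hr : IsPAdicAvatarOf ι ψ r)
  {χ : absoluteGaloisGroup K →ₜ* ℤ_[2]ˣ}
  (hχ : ∀ σ : absoluteGaloisGroup K, (((r σ : GL (Fin 1) (PadicAlgCl 2)) : Matrix (Fin 1) (Fin 1) (PadicAlgCl 2)) 0 0) =
    algebraMap ℚ_[2] (PadicAlgCl 2) (((χ σ : ℤ_[2]ˣ) : ℤ_[2]) : ℚ_[2]))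
  {φ₀ : 𝓞 K →+* ℤ_[2]}
  (hFL : ∀ 𝔮 : HeightOneSpectrum (𝓞 K), ((2 : ℕ) : 𝓞 K) ∉ 𝔮.asIdeal → ψ.IsUnramifiedAt 𝔮 →
    ∀ 𝔔 ∈ 𝔮.primesAbove, ∀ σ : absoluteGaloisGroup K, IsArithFrobAt (𝓞 K) σ 𝔔 →
      ∃ a : 𝓞 K, algebraMap ℚ_[2] (PadicAlgCl 2) ((φ₀ a : ℤ_[2]) : ℚ_[2]) = ι.symm (ψ.valueAtUniformizer 𝔮) ∧
        ActsAsScalarMod W 2 𝔭 M σ a)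
  (hφv : ∀ k : 𝓞 K, k ∈ 𝔭.asIdeal ↔ (2 : ℤ_[2]) ∣ φ₀ k) (h2v : 𝔭.intValuation (2 : 𝓞 K) = WithZero.exp (-1 : ℤ))

include hr hχ hFL hφv h2v in
/-- **(L′) at a Frobenius** (as file 2's `intCast_eq_toZModPow_inv_of_isArithFrobAt`, from the raw link). [cite: Rubin1999, §5 Thm. 5.15 (ii)]
[cite: SerreAbelianLadic1968, Ch. II §2.7] -/
private theorem intCast_eq_toZModPow_inv_of_isArithFrobAt_of_frobLink {𝔮 : HeightOneSpectrum (𝓞 K)} (h2𝔮 : ((2 : ℕ) : 𝓞 K) ∉ 𝔮.asIdeal)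
    (hunr : ψ.IsUnramifiedAt 𝔮) {𝔔 : Ideal (absIntegers (𝓞 K) K)} (h𝔔 : 𝔔 ∈ 𝔮.primesAbove)
    {σ : absoluteGaloisGroup K} (hσ : IsArithFrobAt (𝓞 K) σ 𝔔)
    {j : ℕ} {g : geomPrimaryTorsion W 2} (hg : M ⊓ AddSubgroup.torsionBy (geomPrimaryTorsion W 2) (2 ^ j) = AddSubgroup.zmultiples g)
    (hord : addOrderOf g = 2 ^ j) {a : ℤ} (ha : σ • g = a • g) :
    (a : ZMod (2 ^ j)) = PadicInt.toZModPow j ((χ σ)⁻¹ : ℤ_[2]ˣ) := by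
  obtain ⟨aq, haq, hact⟩ := hFL 𝔮 h2𝔮 hunr 𝔔 h𝔔 σ hσ
  have hent := entry_eq_of_isPAdicAvatarOf ι hr h2𝔮 hunr 𝔔 h𝔔 σ hσ
  rw [hχ σ, ← haq] at hent
  have hinv : (((χ σ)⁻¹ : ℤ_[2]ˣ) : ℤ_[2]) = φ₀ aq := units_inv_eq_of_algebraMap_eq_inv hent
  set N : ℤ := ((PadicInt.toZModPow j (φ₀ aq)).val : ℤ) with hN
  have hNred : PadicInt.toZModPow j (φ₀ (N : 𝓞 K)) = PadicInt.toZModPow j (φ₀ aq) := by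
    rw [toZModPow_intEmb_intCast, hN, intCast_val_toZModPow]
  have hcong : (N : 𝓞 K) - aq ∈ 𝔭.asIdeal ^ j := (FrameSeed.toZModPow_eq_iff_sub_mem_pow hφv h2v j _ _).mp hNred
  have hgM : g ∈ M := (AddSubgroup.mem_inf.mp (generator_mem_layer W 2 hg)).1
  have hgtor : 2 ^ j • g = 0 := by
    have h := pow_zsmul_generator_eq_zero W 2 hg
    rw [← natCast_zsmul]; exact_mod_cast h
  have hσN : σ • g = N • g := hact j N hcong g hgM hgtor
  rw [intCast_eq_intCast_of_smul_eq_zsmul W 2 hord ha hσN, hinv, ← hNred, toZModPow_intEmb_intCast]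

include hst hr hχ hFL hφv h2v in
/-- ★ **(L′) for every `σ`**: `σ • g = a • g` on the generator of `M[2^j]` forces `a ≡ χ(σ)⁻¹ (mod 2^j)` (density, as in file 2).
[cite: SerreAbelianLadic1968, Ch. I §2.2 Cor. 2 (a), §2.3] [cite: Rubin1999, §5 Thm. 5.15 (ii)] -/
private theorem intCast_eq_toZModPow_inv_of_frobLink [W.IsElliptic] (σ : absoluteGaloisGroup K) {j : ℕ} {g : geomPrimaryTorsion W 2}
    (hg : M ⊓ AddSubgroup.torsionBy (geomPrimaryTorsion W 2) (2 ^ j) = AddSubgroup.zmultiples g) (hord : addOrderOf g = 2 ^ j)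
    {a : ℤ} (ha : σ • g = a • g) :
    (a : ZMod (2 ^ j)) = PadicInt.toZModPow j ((χ σ)⁻¹ : ℤ_[2]ˣ) := by
  choose s hs using fun τ : absoluteGaloisGroup K ↦ exists_smul_generator_eq_zsmul W 2 hst hg τ
  set S : Set (HeightOneSpectrum (𝓞 K)) := {𝔮 | ¬ (((2 : ℕ) : 𝓞 K) ∉ 𝔮.asIdeal ∧ ψ.IsUnramifiedAt 𝔮)} with hS
  have hSf : S.Finite := Filter.eventually_cofinite.1 (eventually_notMem_and_isUnramifiedAt (p := 2) ψ)
  have hdense := absoluteGaloisGroup.frobenius_dense Literature.NumberTheory.Automorphic.chebotarev_artinRep_holds K S hSf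
  have hf : Continuous fun τ : absoluteGaloisGroup K ↦ PadicInt.toZModPow j (((χ τ)⁻¹ : ℤ_[2]ˣ) : ℤ_[2]) :=
    (OneUnits.continuous_toZModPow 2 j).comp (Units.continuous_val.comp (continuous_inv.comp χ.continuous))
  have hsc := continuous_intCast_scalar W hg hord s hs
  have hclosed : IsClosed {τ : absoluteGaloisGroup K | (s τ : ZMod (2 ^ j)) = PadicInt.toZModPow j (((χ τ)⁻¹ : ℤ_[2]ˣ) : ℤ_[2])} :=
    isClosed_eq hsc hf
  have hsub : {τ : absoluteGaloisGroup K | ∃ 𝔮 ∉ S, ∃ 𝔔 ∈ 𝔮.primesAbove, IsArithFrobAt (𝓞 K) τ 𝔔} ⊆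
      {τ | (s τ : ZMod (2 ^ j)) = PadicInt.toZModPow j (((χ τ)⁻¹ : ℤ_[2]ˣ) : ℤ_[2])} := by
    rintro τ ⟨𝔮, h𝔮, 𝔔, h𝔔, hτ⟩
    have h𝔮' : ((2 : ℕ) : 𝓞 K) ∉ 𝔮.asIdeal ∧ ψ.IsUnramifiedAt 𝔮 := by
      by_contra hc; exact h𝔮 hc
    exact intCast_eq_toZModPow_inv_of_isArithFrobAt_of_frobLink W ι hr hχ hFL hφv h2v h𝔮'.1 h𝔮'.2 h𝔔 hτ hg hord (hs τ)
  have huniv : Set.univ ⊆ {τ | (s τ : ZMod (2 ^ j)) = PadicInt.toZModPow j (((χ τ)⁻¹ : ℤ_[2]ˣ) : ℤ_[2])} := by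
    rw [← hdense.closure_eq]
    exact hclosed.closure_subset_iff.mpr hsub
  have hσ : (s σ : ZMod (2 ^ j)) = PadicInt.toZModPow j (((χ σ)⁻¹ : ℤ_[2]ˣ) : ℤ_[2]) := huniv (Set.mem_univ σ)
  rw [intCast_eq_intCast_of_smul_eq_zsmul W 2 hord ha (hs σ), hσ]

include hst hr hχ hFL hφv h2v in
/-- **Sign corollaries of (L′)**: `σ` fixes the generator iff `χ(σ) ≡ 1`, negates it iff `χ(σ) ≡ −1 (mod 2^j)`.
[cite: Rubin1999, §5 Thm. 5.15 (ii)] -/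
theorem smul_generator_eq_self_iff_and_eq_neg_iff_of_frobLink [W.IsElliptic] (σ : absoluteGaloisGroup K) {j : ℕ}
    {g : geomPrimaryTorsion W 2} (hg : M ⊓ AddSubgroup.torsionBy (geomPrimaryTorsion W 2) (2 ^ j) = AddSubgroup.zmultiples g)
    (hord : addOrderOf g = 2 ^ j) :
    (σ • g = g ↔ PadicInt.toZModPow j ((χ σ : ℤ_[2]ˣ) : ℤ_[2]) = 1) ∧
      (σ • g = -g ↔ PadicInt.toZModPow j ((χ σ : ℤ_[2]ˣ) : ℤ_[2]) = -1) := by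
  obtain ⟨a, ha⟩ := exists_smul_generator_eq_zsmul W 2 hst hg σ
  have hmul : PadicInt.toZModPow j ((χ σ : ℤ_[2]ˣ) : ℤ_[2]) * PadicInt.toZModPow j (((χ σ)⁻¹ : ℤ_[2]ˣ) : ℤ_[2]) = 1 := by
    rw [← map_mul, Units.mul_inv, map_one]
  have hL := intCast_eq_toZModPow_inv_of_frobLink W hst ι hr hχ hFL hφv h2v σ hg hord ha
  constructor
  · rw [smul_generator_eq_self_iff W 2 hord ha, hL]; exact eq_one_iff_eq_one_of_mul_eq_one hmul
  · rw [smul_generator_eq_neg_iff W 2 hord ha, hL]; exact eq_neg_one_iff_eq_neg_one_of_mul_eq_one hmul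

end LinkRaw

/-! ### The two raw links of the frame -/

section Links

variable (W : WeierstrassCurve K) {ψ : HeckeCharacter K} {v vbar : HeightOneSpectrum (𝓞 K)}
  {Mv Mvbar : AddSubgroup (geomPrimaryTorsion W 2)} (ι : PadicAlgCl 2 ≃+* ℂ) (w : InfinitePlace K) {φ₀ : 𝓞 K →+* ℤ_[2]}
  (hφ₀ : ∀ k : 𝓞 K, algebraMap ℚ_[2] (PadicAlgCl 2) ((φ₀ k : ℤ_[2]) : ℚ_[2]) = ι.symm (w.embedding (k : K)))

include hφ₀ in
/-- **The raw link for `(ψ, v, E[v^∞], φ₀)`** from the Deuring component (clause (frob)). [cite: Rubin1999, §5 Cor. 5.16 (i)–(ii)] -/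
theorem frobLink_of_isPrimaryComponent (hMv : IsPrimaryComponent W 2 ψ v Mv) (hv : ((2 : ℕ) : 𝓞 K) ∈ v.asIdeal) :
    ∀ 𝔮 : HeightOneSpectrum (𝓞 K), ((2 : ℕ) : 𝓞 K) ∉ 𝔮.asIdeal → ψ.IsUnramifiedAt 𝔮 →
      ∀ 𝔔 ∈ 𝔮.primesAbove, ∀ σ : absoluteGaloisGroup K, IsArithFrobAt (𝓞 K) σ 𝔔 →
        ∃ a : 𝓞 K, algebraMap ℚ_[2] (PadicAlgCl 2) ((φ₀ a : ℤ_[2]) : ℚ_[2]) = ι.symm (ψ.valueAtUniformizer 𝔮) ∧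
          ActsAsScalarMod W 2 v Mv σ a := by
  intro 𝔮 h2𝔮 hunr 𝔔 h𝔔 σ hσ
  obtain ⟨a, ha, -, hact⟩ := hMv.exists_generator_actsAsScalarMod (fun h ↦ h2𝔮 (by rw [h]; exact hv)) hunr w h𝔔 hσ
  exact ⟨a, by rw [hφ₀, ha], hact⟩

include hφ₀ in
/-- **The raw link for `(ψ ∘ c, v̄, E[v̄^∞], φ₀ ∘ c⁻¹)`** for a conj-equivariant `ψ` (`(ψ∘c)(ϖ_𝔮) = \overline{ψ(ϖ_𝔮)} = σ_w(c⁻¹ a_𝔮)`, and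
Frobenius acts on `E[v̄^∞]` as `a_𝔮` modulo powers of `v̄`). [cite: Rubin1999, §5 Cor. 5.16 (i)–(ii)] [cite: Jia2026ActaArith, §1] -/
theorem frobLink_galConj_of_isPrimaryComponent (hK : IsImaginaryQuadratic K) (hMvbar : IsPrimaryComponent W 2 ψ vbar Mvbar)
    (hvbar : ((2 : ℕ) : 𝓞 K) ∈ vbar.asIdeal) {c : K ≃ₐ[ℚ] K} (hc : c ≠ 1) (hψc : IsHeckeConjEquivariant c ψ) :
    ∀ 𝔮 : HeightOneSpectrum (𝓞 K), ((2 : ℕ) : 𝓞 K) ∉ 𝔮.asIdeal → (HeckeCharacter.galConj c ψ).IsUnramifiedAt 𝔮 →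
      ∀ 𝔔 ∈ 𝔮.primesAbove, ∀ σ : absoluteGaloisGroup K, IsArithFrobAt (𝓞 K) σ 𝔔 →
        ∃ a : 𝓞 K, algebraMap ℚ_[2] (PadicAlgCl 2)
            ((φ₀.comp (MulSemiringAction.toRingHom (K ≃ₐ[ℚ] K) (𝓞 K) c⁻¹) a : ℤ_[2]) : ℚ_[2]) =
            ι.symm ((HeckeCharacter.galConj c ψ).valueAtUniformizer 𝔮) ∧
          ActsAsScalarMod W 2 vbar Mvbar σ a := by
  intro 𝔮 h2𝔮 hunr 𝔔 h𝔔 σ hσ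
  have hunr' : ψ.IsUnramifiedAt 𝔮 := (hψc.isUnramifiedAt_galConj_iff' 𝔮).mp hunr
  obtain ⟨a, ha, -, hact⟩ := hMvbar.exists_generator_actsAsScalarMod (fun h ↦ h2𝔮 (by rw [h]; exact hvbar)) hunr' w h𝔔 hσ
  refine ⟨a, ?_, hact⟩
  have h := RingHom.congr_fun (embedding_comp_symm_eq_conjugate hK w hc) (a : K)
  rw [RingHom.comp_apply] at h
  calc algebraMap ℚ_[2] (PadicAlgCl 2) (((φ₀.comp (MulSemiringAction.toRingHom (K ≃ₐ[ℚ] K) (𝓞 K) c⁻¹)) a : ℤ_[2]) : ℚ_[2])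
      = ι.symm (w.embedding ((c.symm : K →+* K) (a : K))) := by rw [RingHom.comp_apply, hφ₀]; rfl
    _ = ι.symm (ComplexEmbedding.conjugate w.embedding (a : K)) := by rw [h]
    _ = ι.symm ((HeckeCharacter.galConj c ψ).valueAtUniformizer 𝔮) := by rw [hψc.valueAtUniformizer_galConj', ← ha]; rfl

end Links

/-! ## §2. The junction in `ℤ₂ˣ`, and (H5): deep layers act by signs -/

omit [NumberField K] in
/-- **The junction read in `ℤ₂ˣ`**: `r(σ)₀₀ = χ(σ)` (in `ℚ̄₂`) and `θ(σ) = r̂(σ)` (in `ℂ₂`, the class door's junction) give `χ(σ) = θ(σ)`.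
[cite: CastellaHsieh2018, §3.3] -/
theorem units_eq_of_junction {r : FramedGaloisRep K (PadicAlgCl 2) 1} {χ θ : absoluteGaloisGroup K →ₜ* ℤ_[2]ˣ}
    (hχ : ∀ σ : absoluteGaloisGroup K, (((r σ : GL (Fin 1) (PadicAlgCl 2)) : Matrix (Fin 1) (Fin 1) (PadicAlgCl 2)) 0 0) =
      algebraMap ℚ_[2] (PadicAlgCl 2) (((χ σ : ℤ_[2]ˣ) : ℤ_[2]) : ℚ_[2]))
    {σ : absoluteGaloisGroup K} (hj : ((((θ σ : ℤ_[2]ˣ) : ℤ_[2]) : ℚ_[2]) : ℂ_[2]) = avatarValueAt r σ) : χ σ = θ σ := by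
  have h1 : avatarValueAt r σ = (((((χ σ : ℤ_[2]ˣ) : ℤ_[2]) : ℚ_[2]) : PadicAlgCl 2) : ℂ_[2]) := by
    rw [avatarValueAt, Matrix.GeneralLinearGroup.val_det_apply, Matrix.det_fin_one, hχ σ]
  rw [h1, PadicComplex.coe_eq, PadicComplex.coe_eq] at hj
  have h2 := (algebraMap ℚ_[2] (PadicAlgCl 2)).injective ((algebraMap (PadicAlgCl 2) ℂ_[2]).injective hj)
  exact (Units.ext (PadicInt.ext h2)).symm

section Deep

variable (W : WeierstrassCurve K) [W.IsElliptic] {MA MB : AddSubgroup (geomPrimaryTorsion W 2)} (hinf : MA ⊓ MB = ⊥) (hsup : MA ⊔ MB = ⊤)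
  (hstA : ∀ σ : absoluteGaloisGroup K, ∀ x ∈ MA, σ • x ∈ MA) (hstB : ∀ σ : absoluteGaloisGroup K, ∀ x ∈ MB, σ • x ∈ MB)
  {κA κB : ZpExtension K 2} {γA γB : absoluteGaloisGroup K} (hK : IsImaginaryQuadratic K) (hpair : ZpExtension.IsTopGeneratorPair κA κB γA γB)
  {θ χ : absoluteGaloisGroup K →ₜ* ℤ_[2]ˣ} (hθ2 : ∀ σ : absoluteGaloisGroup K, θ σ = 1 ∨ θ σ = -1)
  (hjunc : ∀ υ ∈ ZpExtension.pairKer κA κB, χ υ = θ υ)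
  (hL : ∀ (σ : absoluteGaloisGroup K) {j : ℕ} {g : geomPrimaryTorsion W 2},
    MA ⊓ AddSubgroup.torsionBy (geomPrimaryTorsion W 2) (2 ^ j) = AddSubgroup.zmultiples g → addOrderOf g = 2 ^ j →
      (σ • g = g ↔ PadicInt.toZModPow j ((χ σ : ℤ_[2]ˣ) : ℤ_[2]) = 1) ∧ (σ • g = -g ↔ PadicInt.toZModPow j ((χ σ : ℤ_[2]ˣ) : ℤ_[2]) = -1))

include hinf hsup hstA hstB hK hpair hθ2 hjunc hL in
/-- ★ **(H5) DEEP LAYERS ACT BY SIGNS, THE `M_A`-SIGN BEING `θ`.** For `j ≥ 2` there is `N` with: every `υ ∈ Gal(K̄/K̃_N)` fixes `g_A^{(j)}` iff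
`θ υ = 1`, acts on `g_A^{(j)}` by `±1`, and acts on `g_B^{(j)}` by `±1`.  The sets `{σ : χ(σ)θ(σ) ≡ 1 (2^j)}` and
`{σ : χ_cyc(σ)θ(σ) ≡ ±1 (2^j)}` are open and contain `Υ` (junction; `χ_cyc|_Υ = ±1`), hence a layer (JLK cofinality); on it `χ ≡ θ = ±1`
(so (L′) gives the `M_A`-claims) and, by the Weil pairing, the `M_B`-scalar is `χ_cyc χ⁻¹ ≡ ±1`.
[cite: Rubin1999, §5 Thm. 5.15] [cite: SilvermanAEC2009, III.8.1] [cite: Washington1997, §13.1] -/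
theorem exists_forall_deep_signs [CharZero K] {gA gB : ℕ → geomPrimaryTorsion W 2}
    (hgA : ∀ j, MA ⊓ AddSubgroup.torsionBy (geomPrimaryTorsion W 2) (2 ^ j) = AddSubgroup.zmultiples (gA j))
    (hgB : ∀ j, MB ⊓ AddSubgroup.torsionBy (geomPrimaryTorsion W 2) (2 ^ j) = AddSubgroup.zmultiples (gB j))
    (hordA : ∀ j, addOrderOf (gA j) = 2 ^ j) (hordB : ∀ j, addOrderOf (gB j) = 2 ^ j) (j : ℕ) (hj : 2 ≤ j) :
    ∃ N : ℕ, ∀ υ ∈ pairLayerSubgroup κA κB N,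
      (υ • gA j = gA j ↔ θ υ = 1) ∧ (υ • gA j = gA j ∨ υ • gA j = -gA j) ∧ (υ • gB j = gB j ∨ υ • gB j = -gB j) := by
  -- the two continuous test maps to `ℤ/2^j`
  set f : absoluteGaloisGroup K → ZMod (2 ^ j) := fun σ ↦ PadicInt.toZModPow j (((χ * θ) σ : ℤ_[2]ˣ) : ℤ_[2]) with hf
  set f' : absoluteGaloisGroup K → ZMod (2 ^ j) :=
    fun σ ↦ PadicInt.toZModPow j (((GaloisRep.cyclotomicCharacter K 2 * θ) σ : ℤ_[2]ˣ) : ℤ_[2]) with hf'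
  have hfc : Continuous f := (OneUnits.continuous_toZModPow 2 j).comp (Units.continuous_val.comp (χ * θ).continuous)
  have hfc' : Continuous f' :=
    (OneUnits.continuous_toZModPow 2 j).comp (Units.continuous_val.comp (GaloisRep.cyclotomicCharacter K 2 * θ).continuous)
  have hopen : IsOpen (f ⁻¹' {1} ∩ f' ⁻¹' {1, -1}) := ((isOpen_discrete _).preimage hfc).inter ((isOpen_discrete _).preimage hfc')
  have hθsq : ∀ σ, θ σ * θ σ = 1 := fun σ ↦ by rcases hθ2 σ with h | h <;> simp [h]
  have hsub : (ZpExtension.pairKer κA κB : Set (absoluteGaloisGroup K)) ⊆ f ⁻¹' {1} ∩ f' ⁻¹' {1, -1} := by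
    intro υ hυ
    have hυ' : υ ∈ ZpExtension.pairKer κA κB := hυ
    refine ⟨?_, ?_⟩
    · show f υ = 1
      simp only [hf, ContinuousMonoidHom.mul_apply, hjunc υ hυ', hθsq, Units.val_one, map_one]
    · show f' υ ∈ ({1, -1} : Set (ZMod (2 ^ j)))
      simp only [hf', ContinuousMonoidHom.mul_apply, Units.val_mul, map_mul]
      rcases cyclotomicCharacter_eq_one_or_eq_neg_one_of_mem_pairKer hK hpair hυ' with h | h <;>
        rcases hθ2 υ with h' | h' <;> simp [h, h']
  obtain ⟨N, hN⟩ := JohnsonLeungKings2011.ClassGroupRow.exists_pairLayerSubgroup_subset 2 κA κB hopen hsub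
  refine ⟨N, fun υ hυ ↦ ?_⟩
  obtain ⟨h1, h2⟩ := hN hυ
  -- on the layer: `χ(υ) ≡ θ(υ) (mod 2^j)`
  have hχθ : PadicInt.toZModPow j ((χ υ : ℤ_[2]ˣ) : ℤ_[2]) = PadicInt.toZModPow j ((θ υ : ℤ_[2]ˣ) : ℤ_[2]) := by
    have h1' : PadicInt.toZModPow j ((χ υ : ℤ_[2]ˣ) : ℤ_[2]) * PadicInt.toZModPow j ((θ υ : ℤ_[2]ˣ) : ℤ_[2]) = 1 := by
      simpa only [hf, Set.mem_preimage, Set.mem_singleton_iff, ContinuousMonoidHom.mul_apply, Units.val_mul, map_mul] using h1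
    have hθθ : PadicInt.toZModPow j ((θ υ : ℤ_[2]ˣ) : ℤ_[2]) * PadicInt.toZModPow j ((θ υ : ℤ_[2]ˣ) : ℤ_[2]) = 1 := by
      rw [← map_mul, ← Units.val_mul, hθsq, Units.val_one, map_one]
    calc PadicInt.toZModPow j ((χ υ : ℤ_[2]ˣ) : ℤ_[2])
        = PadicInt.toZModPow j ((χ υ : ℤ_[2]ˣ) : ℤ_[2]) * (PadicInt.toZModPow j ((θ υ : ℤ_[2]ˣ) : ℤ_[2]) *
            PadicInt.toZModPow j ((θ υ : ℤ_[2]ˣ) : ℤ_[2])) := by rw [hθθ, mul_one]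
      _ = PadicInt.toZModPow j ((θ υ : ℤ_[2]ˣ) : ℤ_[2]) := by rw [← mul_assoc, h1', one_mul]
  have hj1 : (1 : ZMod (2 ^ j)) ≠ -1 := by
    intro h
    have h' := congrArg (ZMod.castHom (pow_dvd_pow 2 hj) (ZMod (2 ^ 2))) h
    rw [map_one, map_neg, map_one] at h'
    exact absurd h' (by decide)
  obtain ⟨hAfix, hAneg⟩ := hL υ (hgA j) (hordA j)
  have hA : (υ • gA j = gA j ↔ θ υ = 1) ∧ (υ • gA j = gA j ∨ υ • gA j = -gA j) := by
    rcases hθ2 υ with h | h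
    · have : υ • gA j = gA j := hAfix.mpr (by rw [hχθ, h, Units.val_one, map_one])
      exact ⟨⟨fun _ ↦ h, fun _ ↦ this⟩, Or.inl this⟩
    · have hneg : υ • gA j = -gA j := hAneg.mpr (by rw [hχθ, h, Units.val_neg, Units.val_one, map_neg, map_one])
      refine ⟨⟨fun hfix ↦ ?_, fun h1 ↦ by rw [h] at h1; exact absurd h1 (by simp)⟩, Or.inr hneg⟩
      exfalso
      have e1 := hAfix.mp hfix
      have e2 := hAneg.mp hneg
      exact hj1 (e1.symm.trans e2)
  refine ⟨hA.1, hA.2, ?_⟩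
  -- the `M_B`-scalar: `a b ≡ χ_cyc`, `a ≡ χ⁻¹ ≡ ±1`, `χ_cyc θ ≡ ±1`
  obtain ⟨a, ha⟩ := exists_smul_generator_eq_zsmul W 2 hstA (hgA j) υ
  obtain ⟨b, hb⟩ := exists_smul_generator_eq_zsmul W 2 hstB (hgB j) υ
  have hWeil := intCast_mul_eq_toZModPow_cyclotomicCharacter_of_cyclic_layers W 2 MA MB hinf hsup (by omega) (hgA j) (hgB j) (hordB j) υ ha hb
  have haθ : (a : ZMod (2 ^ j)) = PadicInt.toZModPow j ((θ υ : ℤ_[2]ˣ) : ℤ_[2]) := by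
    rcases hA.2 with h | h
    · rw [(smul_generator_eq_self_iff W 2 (hordA j) ha).mp h, (hA.1.mp h), Units.val_one, map_one]
    · rw [(smul_generator_eq_neg_iff W 2 (hordA j) ha).mp h]
      rcases hθ2 υ with h' | h'
      · exact absurd (hA.1.mpr h') (fun hfix ↦ hj1 (((smul_generator_eq_self_iff W 2 (hordA j) ha).mp hfix).symm.trans
          ((smul_generator_eq_neg_iff W 2 (hordA j) ha).mp h)))
      · rw [h', Units.val_neg, Units.val_one, map_neg, map_one]
  have hb' : (b : ZMod (2 ^ j)) = f' υ := by
    have hθθ : PadicInt.toZModPow j ((θ υ : ℤ_[2]ˣ) : ℤ_[2]) * PadicInt.toZModPow j ((θ υ : ℤ_[2]ˣ) : ℤ_[2]) = 1 := by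
      rw [← map_mul, ← Units.val_mul, hθsq, Units.val_one, map_one]
    rw [Int.cast_mul, haθ] at hWeil
    simp only [hf', ContinuousMonoidHom.mul_apply, Units.val_mul, map_mul]
    calc (b : ZMod (2 ^ j)) = PadicInt.toZModPow j ((θ υ : ℤ_[2]ˣ) : ℤ_[2]) * PadicInt.toZModPow j ((θ υ : ℤ_[2]ˣ) : ℤ_[2]) * b := by
          rw [hθθ, one_mul]
      _ = _ := by rw [mul_assoc, hWeil, mul_comm]
  have h2' : f' υ = 1 ∨ f' υ = -1 := by simpa using h2
  rcases h2' with h | h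
  · left; exact (smul_generator_eq_self_iff W 2 (hordB j) hb).mpr (by rw [hb', h])
  · right; exact (smul_generator_eq_neg_iff W 2 (hordB j) hb).mpr (by rw [hb', h])

end Deep

/-! ## §3. (H6): the sign-flip `τ₀` -/

section Tau

variable (W : WeierstrassCurve K) [W.IsElliptic] {ψ : HeckeCharacter K} {vA vB : HeightOneSpectrum (𝓞 K)}
  {MA MB : AddSubgroup (geomPrimaryTorsion W 2)}

/-- ★ **(H6) the sign-flip**: `K` imaginary quadratic, `2 = v_A v_B`; `τ₀ ∈ I_{v_B} ∩ Υ` moving `√−1` (-w8 g6 F2′) FIXES `E[v_A^∞]` pointwise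
(Deuring (inert), `ψ` unramified at `v_B`), has `θ τ₀ = 1` whenever `χ τ₀ = θ τ₀` and `χ τ₀ ≡ 1 (mod 4)` is forced by fixing `g_A^{(2)}`
((L′) at `j = 2`), and NEGATES every `g_B^{(j)}` (Weil: its `M_B`-scalar is `χ_cyc(τ₀) = −1`).
[cite: Rubin1999, §5 Thm. 5.15] [cite: SilvermanAEC2009, III.8.1] [cite: Washington1997, Thm. 13.4] -/
theorem exists_tau0 [CharZero K] (hK : IsImaginaryQuadratic K) (hvA : ((2 : ℕ) : 𝓞 K) ∈ vA.asIdeal)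
    (hvB : ((2 : ℕ) : 𝓞 K) ∈ vB.asIdeal) (hne : vB ≠ vA) (hMA : IsPrimaryComponent W 2 ψ vA MA) (hunrB : ψ.IsUnramifiedAt vB)
    (hinf : MA ⊓ MB = ⊥) (hsup : MA ⊔ MB = ⊤) (hstB : ∀ σ : absoluteGaloisGroup K, ∀ x ∈ MB, σ • x ∈ MB)
    {κA κB : ZpExtension K 2} {γA γB : absoluteGaloisGroup K} (hpair : ZpExtension.IsTopGeneratorPair κA κB γA γB)
    {θ χ : absoluteGaloisGroup K →ₜ* ℤ_[2]ˣ} (hθ2 : ∀ σ : absoluteGaloisGroup K, θ σ = 1 ∨ θ σ = -1)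
    (hjunc : ∀ υ ∈ ZpExtension.pairKer κA κB, χ υ = θ υ)
    (hLfix : ∀ (σ : absoluteGaloisGroup K) {g : geomPrimaryTorsion W 2},
      MA ⊓ AddSubgroup.torsionBy (geomPrimaryTorsion W 2) (2 ^ 2) = AddSubgroup.zmultiples g → addOrderOf g = 2 ^ 2 →
        σ • g = g → PadicInt.toZModPow 2 ((χ σ : ℤ_[2]ˣ) : ℤ_[2]) = 1)
    {gA gB : ℕ → geomPrimaryTorsion W 2}
    (hgA : ∀ j, MA ⊓ AddSubgroup.torsionBy (geomPrimaryTorsion W 2) (2 ^ j) = AddSubgroup.zmultiples (gA j))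
    (hgB : ∀ j, MB ⊓ AddSubgroup.torsionBy (geomPrimaryTorsion W 2) (2 ^ j) = AddSubgroup.zmultiples (gB j))
    (hordA : ∀ j, addOrderOf (gA j) = 2 ^ j) (hordB : ∀ j, addOrderOf (gB j) = 2 ^ j) :
    ∃ τ₀ : absoluteGaloisGroup K, τ₀ ∈ ZpExtension.pairKer κA κB ∧ θ τ₀ = 1 ∧ (∀ j, τ₀ • gA j = gA j) ∧ ∀ j, τ₀ • gB j = -gB j := by
  obtain ⟨i, hi⟩ := IsAlgClosed.exists_pow_nat_eq (-1 : AlgebraicClosure K) two_pos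
  obtain ⟨τ₀, hτI, hτΥ, hτi⟩ := UpsilonSurjects.exists_mem_inertia_mem_pairKer_smul_sqrt_neg_one_eq_neg hK hvB hvA hne.symm κA κB hi
  have hfixA : ∀ x ∈ MA, τ₀ • x = x := smul_eq_self_of_mem_inertia W hMA hne.symm hunrB hτI
  have hA : ∀ j, τ₀ • gA j = gA j := fun j ↦ hfixA _ (AddSubgroup.mem_inf.mp (generator_mem_layer W 2 (hgA j))).1
  refine ⟨τ₀, hτΥ, ?_, hA, fun j ↦ ?_⟩
  · -- `χ τ₀ ≡ 1 (mod 4)` and `χ τ₀ = θ τ₀ = ±1`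
    have h4 := hLfix τ₀ (hgA 2) (hordA 2) (hA 2)
    rw [hjunc τ₀ hτΥ] at h4
    rcases hθ2 τ₀ with h | h
    · exact h
    · exfalso
      rw [h, Units.val_neg, Units.val_one, map_neg, map_one] at h4
      exact absurd h4 (by decide)
  · -- the `M_B`-scalar of `τ₀` is `χ_cyc(τ₀) = −1`
    have hcyc : GaloisRep.cyclotomicCharacter K 2 τ₀ = -1 := (cyclotomicCharacter_eq_neg_one_iff_smul_sqrt_neg_one hK hpair hi hτΥ).mpr hτi
    rcases Nat.eq_zero_or_pos j with rfl | hj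
    · have h0 : gB 0 = 0 := by rw [← AddMonoid.addOrderOf_eq_one_iff, hordB 0, pow_zero]
      rw [h0, smul_zero, neg_zero]
    obtain ⟨d, hd⟩ := exists_smul_generator_eq_zsmul W 2 hstB (hgB j) τ₀
    have hdc := intCast_eq_toZModPow_cyclotomicCharacter_of_fix' W hinf hsup (hgA j) (hgB j) (hordA j) (hA j) hd
    rw [hcyc, Units.val_neg, Units.val_one, map_neg, map_one] at hdc
    exact (smul_generator_eq_neg_iff W 2 (hordB j) hd).mpr hdc

end Tau

end Summit.BirchSwinnertonDyer.BirchSwinnertonDyer.Theorems.PrintCf2.CMDivisionTower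

end
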